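import Summits.AtomisticToContinuum.HydrodynamicLimit.Theorems.JParityClosureLocalSecondLawKineticStressAlgebra
import Summits.AtomisticToContinuum.HydrodynamicLimit.Theorems.JParityClosureLocalSecondLawLedgerTwins
import Summits.AtomisticToContinuum.HydrodynamicLimit.Theorems.JParityClosureDensityCapGridUpgrade

/-!
# The resolved strain of the coarse velocity: measurability and a Lipschitz bound
(stmt-AtomisticToContinuum-13081, line `exact-entropy-ledger-three-passivities`; support of the stubs
`stub_passivityKinetic` (P1) and `stub_ledger` (L); file 2 of 3 of the kinetic-stress regularity package)

The resolved strain `∂ₖu_{r,l}(x) = pD k (uC r w · l) x` of the ledger is the (possibly junk) line derivative of the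
re-centred lift of a Lipschitz, non-`C¹` cone field.  This file proves what the junk audit of `T₁` needs about it:
* `θ_r`, `u_r`, `Σ^dev_r` are Borel in (configuration, field point) (`m_r` is jointly continuous — velocity coordinates by
  the ledger's `L.continuous_vel₂` — and division is Borel);
* on the density floor `c ≤ ρ_r` the coarse velocity coincides, as a function of the field point (which is all `pD`
  sees), with the FLOORED velocity `(max ρ_r c)⁻¹ m_{r,l}`, which is jointly continuous for `0 < c`; hence
  `(w, x) ↦ ∂ₖ(floored u)_l(x)` is Borel by Mathlib's `measurable_deriv_with_param` applied to the jointly continuous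
  family of line restrictions `((w,x), t) ↦ (floored u)(x + proj(t eₖ))` (`psvK_measurable_pD_uFloor`);
* the cone kernel is `3/(πr⁴)`-Lipschitz in the minimal-image distance (`gridUp_abs_cone_sub_cone_le`), which is
  `1`-Lipschitz under translations (`Torus.euclidDist_translate_le`), so `ρ_r` and `m_{r,l}` are Lipschitz along every
  line with constants `3/(πr⁴)` and `3(1/2 + ke)/(πr⁴)`, `|m_{r,l}| ≤ 3(1/2+ke)/(πr³)`, and the quotient estimate gives
  the STRAIN CONSTANT `K(r,c,ke) = (3/(πr⁴))(1/2+ke)/c + (3/(πr³))(1/2+ke)(3/(πr⁴))/c²` as a Lipschitz constant of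
  `t ↦ u_{r,l}(x + t eₖ)` on the floor; Mathlib's `norm_deriv_le_of_lip'` then bounds the derivative, junk branch
  included (`abs_pD_uC_le_of_floor`).
WEIGHT CAVEAT (for the composition of P1): `K ∝ (1 + ke)/(c² r⁷)` is crude; the sharp deterministic rate on `Regular`
is `C(c, η₁/σ³)√ke · r^{-5/2}` (one fast particle near the rim of the ball), and the rate `C/r` that an `O(r²)`
resolved anisotropy can beat needs a LOCAL ENERGY CAP `e_r ≤ E` on `[0,τ] × 𝕋³` in the regular event.

References: L. C. Evans, R. F. Gariepy, *Measure Theory and Fine Properties of Functions* (1992), §3.1 (Lipschitz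
functions; only the elementary half `|f′| ≤ Lip f` is used); H. Spohn, *Large Scale Dynamics of Interacting
Particles* (1991), Part I §3.
-/

noncomputable section

namespace Summit.AtomisticToContinuum.HydrodynamicLimit.Theorems.LocalSecondLawLedger

open scoped BigOperators Topology Classical MeasureTheory ENNReal InnerProductSpace
open Filter Set MeasureTheory
open Literature.MathematicalPhysics.KineticTheory
open Literature.Analysis.FluidPDE
open Summit.AtomisticToContinuum.HydrodynamicLimit.Theorems.LocalSecondLawNegative

variable {N : ℕ}

/-! ## Continuity and measurability of the coarse fields in (configuration, field point) -/

/-- The cone weight of particle `i` is jointly continuous in (configuration, field point). -/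
theorem psvK_continuous_cone_particle (r : ℝ) (i : Fin (N + 1)) :
    Continuous fun p : Phase N × T3 => cone r (p.1 i).1 p.2 :=
  continuous_cone_comp r ((continuous_apply i).comp continuous_fst).fst continuous_snd

/-- A coordinate of `m_r` is jointly continuous in (configuration, field point). -/
theorem psvK_continuous_momC_apply_uncurry (r : ℝ) (l : Fin 3) :
    Continuous fun p : Phase N × T3 => momC r p.1 p.2 l := by
  have h : (fun p : Phase N × T3 => momC r p.1 p.2 l) =
      fun p => ((N + 1 : ℕ) : ℝ)⁻¹ * ∑ i, cone r (p.1 i).1 p.2 * (p.1 i).2 l := by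
    funext p; exact psvK_momC_apply_eq_sum r p.1 p.2 l
  rw [h]
  exact continuous_const.mul (continuous_finsetSum _ fun i _ =>
    (psvK_continuous_cone_particle r i).mul (L.continuous_vel₂ i l))

/-- `θ_r` is jointly Borel measurable in (configuration, field point). -/
theorem psvK_measurable_thetaC_uncurry (r : ℝ) :
    Measurable fun p : Phase N × T3 => thetaC r p.1 p.2 := by
  have h : (fun p : Phase N × T3 => thetaC r p.1 p.2) = fun p =>
      2 / 3 * (kinC r p.1 p.2 / rhoC r p.1 p.2 -
        (∑ l, momC r p.1 p.2 l ^ 2) / (2 * rhoC r p.1 p.2 ^ 2)) := by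
    funext p; unfold thetaC; rw [EuclideanSpace.real_norm_sq_eq]
  rw [h]
  have hρ := (continuous_rhoC_uncurry (N := N) r).measurable
  have he := (continuous_kinC_uncurry (N := N) r).measurable
  have hm : Measurable fun p : Phase N × T3 => ∑ l, momC r p.1 p.2 l ^ 2 :=
    (continuous_finsetSum _ fun l _ => (psvK_continuous_momC_apply_uncurry r l).pow 2).measurable
  exact measurable_const.mul ((he.div hρ).sub (hm.div (measurable_const.mul (hρ.pow_const 2))))

/-- A coordinate of `u_r` is jointly Borel measurable. -/
theorem psvK_measurable_uC_apply_uncurry (r : ℝ) (l : Fin 3) :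
    Measurable fun p : Phase N × T3 => uC r p.1 p.2 l := by
  have h : (fun p : Phase N × T3 => uC r p.1 p.2 l) =
      fun p => (rhoC r p.1 p.2)⁻¹ * momC r p.1 p.2 l := by
    funext p; exact psvK_uC_apply r p.1 p.2 l
  rw [h]
  exact (continuous_rhoC_uncurry (N := N) r).measurable.inv.mul
    (psvK_continuous_momC_apply_uncurry r l).measurable

/-- An entry of `Σ^dev_r` is jointly Borel measurable. -/
theorem psvK_measurable_devC_uncurry (r : ℝ) (k l : Fin 3) :
    Measurable fun p : Phase N × T3 => devC r p.1 p.2 k l := by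
  have h : (fun p : Phase N × T3 => devC r p.1 p.2 k l) = fun p =>
      ((N + 1 : ℕ) : ℝ)⁻¹ * ∑ i, cone r (p.1 i).1 p.2 *
          (((p.1 i).2 k - uC r p.1 p.2 k) * ((p.1 i).2 l - uC r p.1 p.2 l)) -
        rhoC r p.1 p.2 * thetaC r p.1 p.2 * (if k = l then 1 else 0) := by
    funext p; exact psvK_devC_eq_sum r p.1 p.2 k l
  rw [h]
  refine (measurable_const.mul (Finset.measurable_sum _ fun i _ => ?_)).sub
    (((continuous_rhoC_uncurry (N := N) r).measurable.mul (psvK_measurable_thetaC_uncurry r)).mul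
      measurable_const)
  exact (psvK_continuous_cone_particle r i).measurable.mul
    (((L.continuous_vel₂ i k).measurable.sub (psvK_measurable_uC_apply_uncurry r k)).mul
      ((L.continuous_vel₂ i l).measurable.sub (psvK_measurable_uC_apply_uncurry r l)))

/-! ## The resolved strain `∂ₖ u_{r,l}`: measurability and a Lipschitz bound on the density floor -/

/-- The FLOORED coarse velocity `(max ρ_r c)⁻¹ m_{r,l}` — equal to `u_{r,l}` wherever `c ≤ ρ_r`, and jointly
continuous when `0 < c`: the honest object behind `∂ₖu_{r,l}` on the regular event.  On the density floor it is the
coarse velocity (as functions of the field point, which is all `pD` sees). -/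
theorem psvK_uFloor_eq_uC {c r : ℝ} {w : Phase N} (h : ∀ y, c ≤ rhoC r w y) (l : Fin 3) :
    (fun y => (max (rhoC r w y) c)⁻¹ * momC r w y l) = fun y => uC r w y l := by
  funext y; rw [max_eq_left (h y), psvK_uC_apply]

/-- The floored velocity is jointly continuous in (configuration, field point) (`0 < c`). -/
theorem psvK_continuous_uFloor_uncurry {c : ℝ} (hc : 0 < c) (r : ℝ) (l : Fin 3) :
    Continuous fun p : Phase N × T3 => (max (rhoC r p.1 p.2) c)⁻¹ * momC r p.1 p.2 l := by
  refine (((continuous_rhoC_uncurry (N := N) r).max continuous_const).inv₀ fun p => ?_).mul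
    (psvK_continuous_momC_apply_uncurry r l)
  exact (lt_of_lt_of_le hc (le_max_right _ _)).ne'

/-- **Measurability of the resolved strain of the floored velocity** in (configuration, field point):
`(w, x) ↦ ∂ₖ ((max (rhoC r w ·) c)⁻¹ * momC r w · l)(x)` is Borel — Mathlib's `measurable_deriv_with_param` for the jointly
continuous family `((w, x), t) ↦ (max (rhoC r w (x + proj (t eₖ))) c)⁻¹ * momC r w (x + proj (t eₖ)) l`, evaluated at `t = 0`. -/
theorem psvK_measurable_pD_uFloor {c : ℝ} (hc : 0 < c) (r : ℝ) (k l : Fin 3) :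
    Measurable fun p : Phase N × T3 => pD k (fun y => (max (rhoC r p.1 y) c)⁻¹ * momC r p.1 y l) p.2 := by
  have hline : Continuous fun q : (Phase N × T3) × ℝ =>
      ((q.1.1, q.1.2 + tproj (q.2 • EuclideanSpace.single k (1 : ℝ))) : Phase N × T3) :=
    (continuous_fst.comp continuous_fst).prodMk
      ((continuous_snd.comp continuous_fst).add
        (Literature.Analysis.FunctionSpaces.Torus.continuous_proj.comp
          (continuous_snd.smul continuous_const)))
  have hfc : Continuous (Function.uncurry fun (p : Phase N × T3) (t : ℝ) =>
      (max (rhoC r p.1 (p.2 + tproj (t • EuclideanSpace.single k (1 : ℝ)))) c)⁻¹ * momC r p.1 (p.2 + tproj (t • EuclideanSpace.single k (1 : ℝ))) l) :=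
    (psvK_continuous_uFloor_uncurry (N := N) hc r l).comp hline
  have hmeas := measurable_deriv_with_param hfc
  have hpair : Measurable fun p : Phase N × T3 => ((p, (0 : ℝ)) : (Phase N × T3) × ℝ) :=
    measurable_id.prodMk measurable_const
  have h0 := hmeas.comp hpair
  -- `pD k f x = deriv (t ↦ f (x + proj (t eₖ))) 0` by definition
  have hdef : (fun p : Phase N × T3 => pD k (fun y => (max (rhoC r p.1 y) c)⁻¹ * momC r p.1 y l) p.2) =
      ((fun q : (Phase N × T3) × ℝ => deriv ((fun (p : Phase N × T3) (t : ℝ) =>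
        (max (rhoC r p.1 (p.2 + tproj (t • EuclideanSpace.single k (1 : ℝ)))) c)⁻¹ * momC r p.1 (p.2 + tproj (t • EuclideanSpace.single k (1 : ℝ))) l) q.1) q.2) ∘
        fun p : Phase N × T3 => ((p, (0 : ℝ)) : (Phase N × T3) × ℝ)) := by
    funext p; rfl
  rw [hdef]
  exact h0

/-- `|v_l| ≤ 1/2 + |v|²/2`. -/
theorem psvK_abs_vel_apply_le (v : V3) (l : Fin 3) : |v l| ≤ 1 / 2 + ‖v‖ ^ 2 / 2 := by
  have h1 : |v l| ≤ ‖v‖ := by rw [← Real.norm_eq_abs]; exact PiLp.norm_apply_le v l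
  nlinarith [sq_nonneg (‖v‖ - 1), norm_nonneg v]

/-- **Lipschitz bound of the cone kernel along a line**:
`|b_r(y, x + proj(t e)) − b_r(y, x + proj(t' e))| ≤ 3/(π r⁴) ‖e‖ |t − t'|` (`0 < r`; the kernel is
`3/(πr⁴)`-Lipschitz in the minimal-image distance, `gridUp_abs_cone_sub_cone_le`, which is `1`-Lipschitz under
translations). -/
theorem psvK_abs_cone_line_sub_le {r : ℝ} (hr : 0 < r) (y x : T3) (e : V3) (t t' : ℝ) :
    |cone r y (x + tproj (t • e)) - cone r y (x + tproj (t' • e))| ≤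
      3 / (Real.pi * r ^ 4) * (‖e‖ * |t - t'|) := by
  have hcomm : ∀ z : T3, cone r y z =
      Summit.AtomisticToContinuum.HydrodynamicLimit.Theorems.DensityCapNegative.cone r z y :=
    fun z => densMod_cone_comm r z y
  rw [hcomm, hcomm]
  refine (gridUp_abs_cone_sub_cone_le hr _ _ y).trans ?_
  refine mul_le_mul_of_nonneg_left ?_ (by positivity)
  calc Torus.euclidDist (x + tproj (t • e)) (x + tproj (t' • e))
      ≤ Torus.euclidDist x x + ‖t • e - t' • e‖ := Torus.euclidDist_translate_le x x _ _
    _ = ‖e‖ * |t - t'| := by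
        rw [Torus.euclidDist_self, zero_add, ← sub_smul, norm_smul, Real.norm_eq_abs, mul_comm]

/-- `ρ_r` is `3/(πr⁴)`-Lipschitz along lines. -/
theorem psvK_abs_rhoC_line_sub_le {r : ℝ} (hr : 0 < r) (w : Phase N) (x : T3) (e : V3) (t t' : ℝ) :
    |rhoC r w (x + tproj (t • e)) - rhoC r w (x + tproj (t' • e))| ≤
      3 / (Real.pi * r ^ 4) * (‖e‖ * |t - t'|) := by
  rw [psvK_rhoC_eq_sum, psvK_rhoC_eq_sum, ← mul_sub, ← Finset.sum_sub_distrib, abs_mul,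
    abs_of_nonneg (by positivity : (0:ℝ) ≤ ((N + 1 : ℕ) : ℝ)⁻¹)]
  calc ((N + 1 : ℕ) : ℝ)⁻¹ *
        |∑ i, (cone r (w i).1 (x + tproj (t • e)) - cone r (w i).1 (x + tproj (t' • e)))|
      ≤ ((N + 1 : ℕ) : ℝ)⁻¹ * ∑ _i : Fin (N + 1), 3 / (Real.pi * r ^ 4) * (‖e‖ * |t - t'|) := by
        gcongr
        exact (Finset.abs_sum_le_sum_abs _ _).trans
          (Finset.sum_le_sum fun i _ => psvK_abs_cone_line_sub_le hr _ _ _ _ _)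
    _ = 3 / (Real.pi * r ^ 4) * (‖e‖ * |t - t'|) := by
        rw [Finset.sum_const, Finset.card_univ, Fintype.card_fin, nsmul_eq_mul, ← mul_assoc,
          inv_mul_cancel₀ (by positivity), one_mul]

/-- `m_{r,l}` is `3(1/2 + ke)/(πr⁴)`-Lipschitz along lines. -/
theorem psvK_abs_momC_line_sub_le {r : ℝ} (hr : 0 < r) (w : Phase N) (x : T3) (e : V3) (t t' : ℝ)
    (l : Fin 3) :
    |momC r w (x + tproj (t • e)) l - momC r w (x + tproj (t' • e)) l| ≤
      3 / (Real.pi * r ^ 4) * (‖e‖ * |t - t'|) * (1 / 2 + ke w) := by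
  rw [psvK_momC_apply_eq_sum, psvK_momC_apply_eq_sum, ← mul_sub, ← Finset.sum_sub_distrib, abs_mul,
    abs_of_nonneg (by positivity : (0:ℝ) ≤ ((N + 1 : ℕ) : ℝ)⁻¹)]
  unfold ke
  calc ((N + 1 : ℕ) : ℝ)⁻¹ * |∑ i, (cone r (w i).1 (x + tproj (t • e)) * (w i).2 l -
          cone r (w i).1 (x + tproj (t' • e)) * (w i).2 l)|
      ≤ ((N + 1 : ℕ) : ℝ)⁻¹ *
          ∑ i, 3 / (Real.pi * r ^ 4) * (‖e‖ * |t - t'|) * (1 / 2 + ‖(w i).2‖ ^ 2 / 2) := by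
        gcongr
        refine (Finset.abs_sum_le_sum_abs _ _).trans (Finset.sum_le_sum fun i _ => ?_)
        rw [← sub_mul, abs_mul]
        exact mul_le_mul (psvK_abs_cone_line_sub_le hr _ _ _ _ _) (psvK_abs_vel_apply_le _ _)
          (abs_nonneg _) (by positivity)
    _ = 3 / (Real.pi * r ^ 4) * (‖e‖ * |t - t'|) *
          (1 / 2 + ((N + 1 : ℕ) : ℝ)⁻¹ * ∑ i, ‖(w i).2‖ ^ 2 / 2) := by
        rw [← Finset.mul_sum, Finset.sum_add_distrib, Finset.sum_const, Finset.card_univ,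
          Fintype.card_fin, nsmul_eq_mul]
        have hN : ((N + 1 : ℕ) : ℝ) ≠ 0 := by positivity
        field_simp

/-- `|m_{r,l}| ≤ 3(1/2 + ke)/(πr³)`. -/
theorem psvK_abs_momC_apply_le {r : ℝ} (hr : 0 < r) (w : Phase N) (y : T3) (l : Fin 3) :
    |momC r w y l| ≤ 3 / (Real.pi * r ^ 3) * (1 / 2 + ke w) := by
  rw [psvK_momC_apply_eq_sum, abs_mul, abs_of_nonneg (by positivity : (0:ℝ) ≤ ((N + 1 : ℕ) : ℝ)⁻¹)]
  unfold ke
  calc ((N + 1 : ℕ) : ℝ)⁻¹ * |∑ i, cone r (w i).1 y * (w i).2 l|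
      ≤ ((N + 1 : ℕ) : ℝ)⁻¹ * ∑ i, 3 / (Real.pi * r ^ 3) * (1 / 2 + ‖(w i).2‖ ^ 2 / 2) := by
        gcongr
        refine (Finset.abs_sum_le_sum_abs _ _).trans (Finset.sum_le_sum fun i _ => ?_)
        rw [abs_mul, abs_of_nonneg (cone_nonneg hr _ _)]
        exact mul_le_mul (DensityCapNegative.cone_le hr _ _) (psvK_abs_vel_apply_le _ _) (abs_nonneg _)
          (by positivity)
    _ = 3 / (Real.pi * r ^ 3) * (1 / 2 + ((N + 1 : ℕ) : ℝ)⁻¹ * ∑ i, ‖(w i).2‖ ^ 2 / 2) := by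
        rw [← Finset.mul_sum, Finset.sum_add_distrib, Finset.sum_const, Finset.card_univ,
          Fintype.card_fin, nsmul_eq_mul]
        have hN : ((N + 1 : ℕ) : ℝ) ≠ 0 := by positivity
        field_simp

/-- The STRAIN CONSTANT `K(r, c, E) = (3/(πr⁴))(1/2 + E)/c + (3/(πr³))(1/2 + E)(3/(πr⁴))/c²` — a Lipschitz
constant of `t ↦ u_{r,l}(x + t eₖ)` on `{ρ_r ≥ c}` for a configuration of mean kinetic energy `E` — is non-negative. -/
theorem psvK_strainConst_nonneg {r c E : ℝ} (hr : 0 < r) (hc : 0 < c) (hE : 0 ≤ E) :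
    0 ≤ 3 / (Real.pi * r ^ 4) * (1 / 2 + E) / c +
      3 / (Real.pi * r ^ 3) * (1 / 2 + E) * (3 / (Real.pi * r ^ 4)) / c ^ 2 := by
  positivity

/-- Elementary quotient estimate: `|M/R − M₀/R₀| ≤ A/c + Mb·B/c²` from `|M − M₀| ≤ A`, `|R − R₀| ≤ B`,
`|M₀| ≤ Mb` and the floor `c ≤ R, R₀` (`0 < c`). -/
theorem psvK_abs_div_sub_div_le {M M₀ R R₀ A B Mb c : ℝ} (hc : 0 < c) (hR : c ≤ R) (hR₀ : c ≤ R₀)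
    (hM : |M - M₀| ≤ A) (hRR : |R - R₀| ≤ B) (hMb : |M₀| ≤ Mb) :
    |R⁻¹ * M - R₀⁻¹ * M₀| ≤ A / c + Mb * B / c ^ 2 := by
  have hRpos : 0 < R := lt_of_lt_of_le hc hR
  have hR₀pos : 0 < R₀ := lt_of_lt_of_le hc hR₀
  have hA : 0 ≤ A := (abs_nonneg _).trans hM
  have hB : 0 ≤ B := (abs_nonneg _).trans hRR
  have hMb0 : 0 ≤ Mb := (abs_nonneg _).trans hMb
  have key : R⁻¹ * M - R₀⁻¹ * M₀ = (M - M₀) / R + M₀ * (R₀ - R) / (R * R₀) := by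
    field_simp; ring
  rw [key]
  refine (abs_add_le _ _).trans (add_le_add ?_ ?_)
  · rw [abs_div, abs_of_pos hRpos]
    calc |M - M₀| / R ≤ A / R := div_le_div_of_nonneg_right hM hRpos.le
      _ ≤ A / c := div_le_div_of_nonneg_left hA hc hR
  · rw [abs_div, abs_mul, abs_of_pos (mul_pos hRpos hR₀pos), abs_sub_comm]
    have hnum : |M₀| * |R - R₀| ≤ Mb * B := mul_le_mul hMb hRR (abs_nonneg _) hMb0
    have hden : c ^ 2 ≤ R * R₀ := by rw [sq]; exact mul_le_mul hR hR₀ hc.le hRpos.le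
    calc |M₀| * |R - R₀| / (R * R₀) ≤ Mb * B / (R * R₀) :=
          div_le_div_of_nonneg_right hnum (mul_pos hRpos hR₀pos).le
      _ ≤ Mb * B / c ^ 2 := div_le_div_of_nonneg_left (mul_nonneg hMb0 hB) (by positivity) hden

/-- **Bound of the resolved strain of the floored velocity**: `|∂ₖ ((max (rhoC r w ·) c)⁻¹ * momC r w · l)(x)| ≤ K(r, c, ke w)`
(`0 < r`, `0 < c`) — the line restriction `t ↦ uFloor(x + t eₖ)` is Lipschitz with that constant and Mathlib's
`norm_deriv_le_of_lip'` bounds the (possibly junk) derivative at `t = 0`. -/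
theorem psvK_abs_pD_uFloor_le {r c : ℝ} (hr : 0 < r) (hc : 0 < c) (w : Phase N) (x : T3) (k l : Fin 3) :
    |pD k (fun y => (max (rhoC r w y) c)⁻¹ * momC r w y l) x| ≤ (3 / (Real.pi * r ^ 4) * (1 / 2 + ke w) / c + 3 / (Real.pi * r ^ 3) * (1 / 2 + ke w) * (3 / (Real.pi * r ^ 4)) / c ^ 2) := by
  set e : V3 := EuclideanSpace.single k (1 : ℝ) with he
  have he1 : ‖e‖ = 1 := by rw [he, PiLp.norm_single, norm_one]
  set g : ℝ → ℝ := fun t => (max (rhoC r w (x + tproj (t • e))) c)⁻¹ * momC r w (x + tproj (t • e)) l with hg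
  have hK : 0 ≤ (3 / (Real.pi * r ^ 4) * (1 / 2 + ke w) / c + 3 / (Real.pi * r ^ 3) * (1 / 2 + ke w) * (3 / (Real.pi * r ^ 4)) / c ^ 2) := psvK_strainConst_nonneg hr hc (ke_nonneg w)
  have hlip : ∀ t, |g t - g 0| ≤ (3 / (Real.pi * r ^ 4) * (1 / 2 + ke w) / c + 3 / (Real.pi * r ^ 3) * (1 / 2 + ke w) * (3 / (Real.pi * r ^ 4)) / c ^ 2) * |t - 0| := by
    intro t
    have hM := psvK_abs_momC_line_sub_le hr w x e t 0 l
    have hR : |max (rhoC r w (x + tproj (t • e))) c - max (rhoC r w (x + tproj ((0 : ℝ) • e))) c| ≤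
        3 / (Real.pi * r ^ 4) * (‖e‖ * |t - 0|) :=
      (abs_max_sub_max_le_abs _ _ _).trans (psvK_abs_rhoC_line_sub_le hr w x e t 0)
    have hMb := psvK_abs_momC_apply_le hr w (x + tproj ((0 : ℝ) • e)) l
    have h := psvK_abs_div_sub_div_le hc (le_max_right _ _) (le_max_right _ _) hM hR hMb
    rw [he1, one_mul] at h
    calc |g t - g 0| = _ := rfl
      _ ≤ _ := h
      _ = (3 / (Real.pi * r ^ 4) * (1 / 2 + ke w) / c + 3 / (Real.pi * r ^ 3) * (1 / 2 + ke w) * (3 / (Real.pi * r ^ 4)) / c ^ 2) * |t - 0| := by ring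
  have h := norm_deriv_le_of_lip' (f := g) (x₀ := 0) hK (Eventually.of_forall fun t => by
    rw [Real.norm_eq_abs, Real.norm_eq_abs]; exact hlip t)
  rw [Real.norm_eq_abs] at h
  exact h

/-- On the density floor: `|∂ₖ u_{r,l}(x)| ≤ K(r, c, ke w)`. -/
theorem psvK_abs_pD_uC_le {r c : ℝ} (hr : 0 < r) (hc : 0 < c) {w : Phase N} (hfl : ∀ y, c ≤ rhoC r w y)
    (x : T3) (k l : Fin 3) :
    |pD k (fun y => uC r w y l) x| ≤ (3 / (Real.pi * r ^ 4) * (1 / 2 + ke w) / c + 3 / (Real.pi * r ^ 3) * (1 / 2 + ke w) * (3 / (Real.pi * r ^ 4)) / c ^ 2) := by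
  rw [← psvK_uFloor_eq_uC hfl l]
  exact psvK_abs_pD_uFloor_le hr hc w x k l



/-! ## Registered sub-goal (stmt-AtomisticToContinuum-13081; signature verbatim) -/

/-- Registered sub-goal `abs_pD_uC_le_of_floor`: the resolved strain is bounded by the strain constant on the
density floor. -/
theorem abs_pD_uC_le_of_floor :
  ∀ {N : ℕ} {r c : ℝ}, 0 < r → 0 < c → ∀ {w : Phase N}, (∀ y, c ≤ rhoC r w y) → ∀ (x : T3) (k l : Fin 3), |pD k (fun y => uC r w y l) x| ≤ 3 / (Real.pi * r ^ 4) * (1 / 2 + ke w) / c + 3 / (Real.pi * r ^ 3) * (1 / 2 + ke w) * (3 / (Real.pi * r ^ 4)) / c ^ 2 :=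
  fun hr hc _ hfl x k l => psvK_abs_pD_uC_le hr hc hfl x k l

end Summit.AtomisticToContinuum.HydrodynamicLimit.Theorems.LocalSecondLawLedger

end
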